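import Mathlib
import HarnessLib

/-!
# Hankel dominance ("root trick"): a bounded positive-definite sequence dominates its shift

Cell `pub-gaugeboot` (HOME `run/shared/lean/pub/pub-gaugeboot/`), seat lean3 gen 6; adopted VERBATIM (namespace and header only changed)
from the formulation lane's sketch `HOME/pub-gaugeboot-loop/wloops/DiffHankelSketch.lean` (sha256 `1fcbe4695cbef919…`, loop gen 11;
`LIMIT-SOUNDNESS.md` §S.4, item L-LIM-1 of §L), as authorised by the lead (FANOUT-PLAN A158 (6) / A159 (5): "ONE neutral Mathlib-only
module under GaugeBoot/ once the LIMIT rows sign" — they signed 2026-08-22T02:58:47Z, CERTIFIED §E E1–E2).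

HONEST FRAMING: certified bounds on lattice expectations at stated coupling, gauge group, dimension and torus size; NOT a mass gap,
NOT a continuum limit, NOT a string tension; NOT Yang–Mills-summit-bearing (barriers `FixedCouplingUltralocality`,
`PerturbativeInvisibility`). Class LIMIT = limit points of even-side torus states, NOT a finite-torus bound. THIS MODULE IS PURE
MATHEMATICS (Mathlib only): nothing in it refers to lattice gauge theory.

LEMMA HD (Berg–Christensen–Ressel, *Harmonic Analysis on Semigroups* (1984), Ch. 4, Prop. 1.12 — the "root trick"; our formalisation
of the published ten-line argument): if `f : ℕ → ℝ` is bounded by `1` in absolute value and every finite Hankel form is positive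
semidefinite, `0 ≤ Σ_{a,b<N} d_a d_b f(a+b)` for all `N` and all `d`, then the shifted form is dominated by the unshifted one,
`|Σ_{a,b<n} c_a c_b f(a+b+1)| ≤ Σ_{a,b<n} c_a c_b f(a+b)` (`abs_hankel_shift_le`); equivalently the DIFFERENCE-Hankel forms
`Σ c_a c_b (f(a+b) − f(a+b+1))` and `Σ c_a c_b (f(a+b) + f(a+b+1))` are non-negative (`hankel_sub_shift_nonneg`,
`hankel_add_shift_nonneg`, and the shifted variant `hankel_sub_shift_nonneg_succ`).
Mechanism: `h_k := Σ c_a c_b f(a+b+k)`; `h_{2k} ≥ 0` (Hankel form of the shifted coefficient vector, `sum_shiftTrunc_shiftTrunc`), `|h_k| ≤ (Σ|c_a|)²`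
(boundedness, `abs_hankelForm_le`), Cauchy–Schwarz for the semidefinite form gives `h_k² ≤ h_0 · h_{2k}` (`hankelForm_sq_le`), hence
`|h_1|^(2^j) ≤ h_0^(2^j − 1) · M` and `j → ∞` (Bernoulli + Archimedes) gives `|h_1| ≤ h_0` (`abs_hankelForm_one_le_zero`).
Intended use (by the binding seats, not here): with `f t := ∫ W̄(t × m) dμ` at an infinite-volume limit point along even tori
(`Summit.QuantumFields.GaugeBoot.WilsonLoopLimit.wilsonLoop_integral_limit_gram_even/_odd`, `…_hankel`), the difference-Hankel blocks of
the class-LIMIT rows; the sketch's instantiation section (≈ 60 lines against `WilsonLoopLimitMonotone`) is NOT part of this module.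
-/

namespace Summit.QuantumFields.GaugeBoot.Hankel


open Finset

/-- Truncated shift of a coefficient sequence: `shiftTrunc n k c a = c (a - k)` for `k ≤ a < k + n`, else `0`. -/
def shiftTrunc (n k : ℕ) (c : ℕ → ℝ) (a : ℕ) : ℝ := if k ≤ a ∧ a < k + n then c (a - k) else 0

/-- The shifted Hankel quadratic form `hankelForm f n k c = Σ_{a,b<n} c_a c_b f(a+b+k)`. -/
def hankelForm (f : ℕ → ℝ) (n k : ℕ) (c : ℕ → ℝ) : ℝ :=
  ∑ a ∈ range n, ∑ b ∈ range n, c a * c b * f (a + b + k)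

/-- One-dimensional reindexing: summing against the truncated shift. -/
theorem sum_shiftTrunc_mul (g c : ℕ → ℝ) (n l N : ℕ) (hN : l + n ≤ N) :
    ∑ b ∈ range N, shiftTrunc n l c b * g b = ∑ b ∈ range n, c b * g (l + b) := by
  have hsub : range (l + n) ⊆ range N := range_subset_range.2 hN
  have step1 : ∑ b ∈ range N, shiftTrunc n l c b * g b = ∑ b ∈ range (l + n), shiftTrunc n l c b * g b := by
    refine (sum_subset hsub (fun b hb hb' => ?_)).symm
    have hc : ¬ (l ≤ b ∧ b < l + n) := by simp only [mem_range] at hb hb'; omega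
    have hz : shiftTrunc n l c b = 0 := if_neg hc
    rw [hz, zero_mul]
  rw [step1, sum_range_add]
  have h1 : ∑ b ∈ range l, shiftTrunc n l c b * g b = 0 := sum_eq_zero (fun b hb => by
    have hc : ¬ (l ≤ b ∧ b < l + n) := by simp only [mem_range] at hb; omega
    have hz : shiftTrunc n l c b = 0 := if_neg hc
    rw [hz, zero_mul])
  rw [h1, zero_add]
  refine sum_congr rfl (fun b hb => ?_)
  have hc : l ≤ l + b ∧ l + b < l + n := by simp only [mem_range] at hb; omega
  have hv : shiftTrunc n l c (l + b) = c (l + b - l) := if_pos hc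
  rw [hv, Nat.add_sub_cancel_left]

/-- Two-dimensional reindexing: the Hankel form of two truncated shifts is a shifted Hankel form. -/
theorem sum_shiftTrunc_shiftTrunc (f c : ℕ → ℝ) (n k l N : ℕ) (hk : k + n ≤ N) (hl : l + n ≤ N) :
    ∑ a ∈ range N, ∑ b ∈ range N, shiftTrunc n k c a * shiftTrunc n l c b * f (a + b) = hankelForm f n (k + l) c := by
  have inner : ∀ a, ∑ b ∈ range N, shiftTrunc n k c a * shiftTrunc n l c b * f (a + b)
      = shiftTrunc n k c a * ∑ b ∈ range n, c b * f (a + (l + b)) := by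
    intro a
    have h := sum_shiftTrunc_mul (fun b => f (a + b)) c n l N hl
    beta_reduce at h
    rw [← h, mul_sum]
    exact sum_congr rfl (fun b _ => by ring)
  simp_rw [inner]
  have h2 := sum_shiftTrunc_mul (fun a => ∑ b ∈ range n, c b * f (a + (l + b))) c n k N hk
  beta_reduce at h2
  rw [h2]
  unfold hankelForm
  refine sum_congr rfl (fun a _ => ?_)
  rw [mul_sum]
  refine sum_congr rfl (fun b _ => ?_)
  have e : k + a + (l + b) = a + b + (k + l) := by omega
  rw [e]; ring

/-- Even shifts are Hankel forms of shifted vectors, hence non-negative. -/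
theorem hankelForm_add_self_nonneg (f : ℕ → ℝ)
    (hp : ∀ (N : ℕ) (d : ℕ → ℝ), 0 ≤ ∑ a ∈ range N, ∑ b ∈ range N, d a * d b * f (a + b))
    (c : ℕ → ℝ) (n k : ℕ) : 0 ≤ hankelForm f n (k + k) c := by
  have h0 := hp (k + n) (shiftTrunc n k c)
  rw [sum_shiftTrunc_shiftTrunc f c n k k (k + n) le_rfl le_rfl] at h0
  exact h0

/-- Cauchy–Schwarz for the semidefinite Hankel form: `hankelForm(k+l)² ≤ hankelForm(2k) · hankelForm(2l)`. -/
theorem hankelForm_sq_le (f : ℕ → ℝ)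
    (hp : ∀ (N : ℕ) (d : ℕ → ℝ), 0 ≤ ∑ a ∈ range N, ∑ b ∈ range N, d a * d b * f (a + b))
    (c : ℕ → ℝ) (n k l : ℕ) :
    hankelForm f n (k + l) c ^ 2 ≤ hankelForm f n (k + k) c * hankelForm f n (l + l) c := by
  set N := k + l + n with hN
  have hk : k + n ≤ N := by omega
  have hl : l + n ≤ N := by omega
  have key : ∀ t : ℝ,
      0 ≤ hankelForm f n (l + l) c * (t * t) + (2 * hankelForm f n (k + l) c) * t + hankelForm f n (k + k) c := by
    intro t
    have h0 := hp N (fun a => shiftTrunc n k c a + t * shiftTrunc n l c a)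
    beta_reduce at h0
    have expand : ∑ a ∈ range N, ∑ b ∈ range N,
        (shiftTrunc n k c a + t * shiftTrunc n l c a) * (shiftTrunc n k c b + t * shiftTrunc n l c b) * f (a + b)
        = (∑ a ∈ range N, ∑ b ∈ range N, shiftTrunc n k c a * shiftTrunc n k c b * f (a + b))
          + t * (∑ a ∈ range N, ∑ b ∈ range N, shiftTrunc n k c a * shiftTrunc n l c b * f (a + b))
          + t * (∑ a ∈ range N, ∑ b ∈ range N, shiftTrunc n l c a * shiftTrunc n k c b * f (a + b))
          + t * t * (∑ a ∈ range N, ∑ b ∈ range N, shiftTrunc n l c a * shiftTrunc n l c b * f (a + b)) := by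
      simp only [mul_sum, ← sum_add_distrib]
      exact sum_congr rfl (fun a _ => sum_congr rfl (fun b _ => by ring))
    rw [expand, sum_shiftTrunc_shiftTrunc f c n k k N hk hk, sum_shiftTrunc_shiftTrunc f c n k l N hk hl,
      sum_shiftTrunc_shiftTrunc f c n l k N hl hk, sum_shiftTrunc_shiftTrunc f c n l l N hl hl, add_comm l k] at h0
    linarith
  have hd := discrim_le_zero key
  rw [discrim] at hd
  nlinarith [hd]

/-- Boundedness: `|hankelForm f n k c| ≤ (Σ |c_a|)²` when `|f| ≤ 1`. -/
theorem abs_hankelForm_le (f : ℕ → ℝ) (hb : ∀ t, |f t| ≤ 1) (c : ℕ → ℝ) (n k : ℕ) :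
    |hankelForm f n k c| ≤ (∑ a ∈ range n, |c a|) ^ 2 := by
  unfold hankelForm
  calc |∑ a ∈ range n, ∑ b ∈ range n, c a * c b * f (a + b + k)|
      ≤ ∑ a ∈ range n, |∑ b ∈ range n, c a * c b * f (a + b + k)| := abs_sum_le_sum_abs _ _
    _ ≤ ∑ a ∈ range n, ∑ b ∈ range n, |c a| * |c b| := by
        refine sum_le_sum (fun a _ => (abs_sum_le_sum_abs _ _).trans (sum_le_sum (fun b _ => ?_)))
        rw [abs_mul, abs_mul]
        calc |c a| * |c b| * |f (a + b + k)| ≤ |c a| * |c b| * 1 :=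
              mul_le_mul_of_nonneg_left (hb _) (by positivity)
          _ = |c a| * |c b| := mul_one _
    _ = (∑ a ∈ range n, |c a|) ^ 2 := by rw [sq, sum_mul_sum]

/-- **Lemma HD, range form (the root trick).** `|hankelForm f n 1 c| ≤ hankelForm f n 0 c`. -/
theorem abs_hankelForm_one_le_zero (f : ℕ → ℝ) (hb : ∀ t, |f t| ≤ 1)
    (hp : ∀ (N : ℕ) (d : ℕ → ℝ), 0 ≤ ∑ a ∈ range N, ∑ b ∈ range N, d a * d b * f (a + b))
    (n : ℕ) (c : ℕ → ℝ) : |hankelForm f n 1 c| ≤ hankelForm f n 0 c := by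
  have hMb : ∀ k, |hankelForm f n k c| ≤ (∑ a ∈ range n, |c a|) ^ 2 := fun k => abs_hankelForm_le f hb c n k
  have h0nn : 0 ≤ hankelForm f n 0 c := by simpa using hankelForm_add_self_nonneg f hp c n 0
  have cs : ∀ k, hankelForm f n k c ^ 2 ≤ hankelForm f n (k + k) c * hankelForm f n 0 c := fun k => by
    simpa using hankelForm_sq_le f hp c n k 0
  rcases h0nn.eq_or_lt with hz | hpos
  · -- degenerate case `hankelForm 0 = 0`: Cauchy–Schwarz alone gives `hankelForm 1 = 0`
    have h1 : hankelForm f n 1 c ^ 2 ≤ 0 := by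
      have h := cs 1
      rw [← hz, mul_zero] at h
      exact h
    have h1z : hankelForm f n 1 c = 0 := (pow_eq_zero_iff two_ne_zero).1 (le_antisymm h1 (sq_nonneg _))
    rw [h1z, ← hz]; simp
  · -- the iteration `|hankelForm 1|^(2^j) ≤ (hankelForm 0)^(2^j - 1) · |hankelForm (2^j)|`
    have P : ∀ j : ℕ,
        |hankelForm f n 1 c| ^ (2 ^ j) ≤ hankelForm f n 0 c ^ (2 ^ j - 1) * |hankelForm f n (2 ^ j) c| := by
      intro j
      induction j with
      | zero => simp
      | succ j ih =>
        set m := 2 ^ j with hm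
        have hm1 : 1 ≤ m := Nat.one_le_two_pow
        have e2 : 2 ^ (j + 1) = 2 * m := by rw [pow_succ]; ring
        rw [e2]
        have emm : m + m = 2 * m := by ring
        have hHm : 0 ≤ hankelForm f n (2 * m) c := by rw [← emm]; exact hankelForm_add_self_nonneg f hp c n m
        have csm : hankelForm f n m c ^ 2 ≤ hankelForm f n (2 * m) c * hankelForm f n 0 c := by rw [← emm]; exact cs m
        have ih2 : (|hankelForm f n 1 c| ^ m) * (|hankelForm f n 1 c| ^ m)
            ≤ (hankelForm f n 0 c ^ (m - 1) * |hankelForm f n m c|) * (hankelForm f n 0 c ^ (m - 1) * |hankelForm f n m c|) :=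
          mul_self_le_mul_self (by positivity) ih
        have lhs : |hankelForm f n 1 c| ^ (2 * m) = (|hankelForm f n 1 c| ^ m) * (|hankelForm f n 1 c| ^ m) := by
          rw [two_mul, pow_add]
        have rhs : hankelForm f n 0 c ^ (2 * m - 1)
            = hankelForm f n 0 c ^ (m - 1) * hankelForm f n 0 c ^ (m - 1) * hankelForm f n 0 c := by
          rw [← pow_add, ← pow_succ]; congr 1; omega
        have hsq : |hankelForm f n m c| * |hankelForm f n m c| = hankelForm f n m c ^ 2 := by rw [sq, ← abs_mul, abs_mul_self]
        rw [lhs, rhs, abs_of_nonneg hHm]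
        calc (|hankelForm f n 1 c| ^ m) * (|hankelForm f n 1 c| ^ m)
            ≤ (hankelForm f n 0 c ^ (m - 1) * |hankelForm f n m c|) * (hankelForm f n 0 c ^ (m - 1) * |hankelForm f n m c|) := ih2
          _ = hankelForm f n 0 c ^ (m - 1) * hankelForm f n 0 c ^ (m - 1) * (|hankelForm f n m c| * |hankelForm f n m c|) := by ring
          _ = hankelForm f n 0 c ^ (m - 1) * hankelForm f n 0 c ^ (m - 1) * (hankelForm f n m c ^ 2) := by rw [hsq]
          _ ≤ hankelForm f n 0 c ^ (m - 1) * hankelForm f n 0 c ^ (m - 1) * (hankelForm f n (2 * m) c * hankelForm f n 0 c) :=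
              mul_le_mul_of_nonneg_left csm (by positivity)
          _ = hankelForm f n 0 c ^ (m - 1) * hankelForm f n 0 c ^ (m - 1) * hankelForm f n 0 c * hankelForm f n (2 * m) c := by ring
    -- conclusion by contradiction: if `hankelForm 0 < |hankelForm 1|` the iteration contradicts boundedness
    by_contra hcon
    rw [not_le] at hcon
    set A := hankelForm f n 0 c with hA
    set B := |hankelForm f n 1 c| with hB
    set M := (∑ a ∈ range n, |c a|) ^ 2 with hM
    have PM : ∀ j : ℕ, B ^ (2 ^ j) ≤ A ^ (2 ^ j - 1) * M := fun j =>
      (P j).trans (mul_le_mul_of_nonneg_left (hMb _) (pow_nonneg hpos.le _))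
    have hr : 0 < B / A - 1 := by
      rw [sub_pos, lt_div_iff₀ hpos]; linarith
    obtain ⟨N₀, hN₀⟩ := exists_nat_gt (M / (A * (B / A - 1)))
    have hBm := PM N₀
    set m := 2 ^ N₀ with hm
    have hm1 : 1 ≤ m := Nat.one_le_two_pow
    have hBA : B = B / A * A := (div_mul_cancel₀ B hpos.ne').symm
    have bern : 1 + (m : ℝ) * (B / A - 1) ≤ (B / A) ^ m := by
      have h := one_add_mul_le_pow (show (-2 : ℝ) ≤ B / A - 1 by linarith) m
      have e : 1 + (B / A - 1) = B / A := by ring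
      rw [e] at h
      exact h
    have hAm : A ^ m = A ^ (m - 1) * A := by rw [← pow_succ]; congr 1; omega
    have key : (1 + (m : ℝ) * (B / A - 1)) * A ^ m ≤ A ^ (m - 1) * M := by
      calc (1 + (m : ℝ) * (B / A - 1)) * A ^ m ≤ (B / A) ^ m * A ^ m :=
            mul_le_mul_of_nonneg_right bern (by positivity)
        _ = B ^ m := by rw [← mul_pow, ← hBA]
        _ ≤ A ^ (m - 1) * M := hBm
    rw [hAm] at key
    have hApos : 0 < A ^ (m - 1) := pow_pos hpos _
    have key2 : (1 + (m : ℝ) * (B / A - 1)) * A ≤ M := by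
      refine le_of_mul_le_mul_left ?_ hApos
      calc A ^ (m - 1) * ((1 + (m : ℝ) * (B / A - 1)) * A)
          = (1 + (m : ℝ) * (B / A - 1)) * (A ^ (m - 1) * A) := by ring
        _ ≤ A ^ (m - 1) * M := key
    have hmN : (N₀ : ℝ) ≤ (m : ℝ) := by
      rw [hm]; exact_mod_cast (Nat.lt_two_pow_self (n := N₀)).le
    have hbig : M < (m : ℝ) * (B / A - 1) * A := by
      have hprod : 0 < A * (B / A - 1) := mul_pos hpos hr
      have h1 : M / (A * (B / A - 1)) < m := hN₀.trans_le hmN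
      rw [div_lt_iff₀ hprod] at h1
      linarith
    nlinarith [key2, hbig, hpos]

/-- **Lemma HD (finite-set form, as displayed in LIMIT-SOUNDNESS.md §S.4).** -/
theorem abs_hankel_shift_le (f : ℕ → ℝ) (hb : ∀ t, |f t| ≤ 1)
    (hp : ∀ (S : Finset ℕ) (c : ℕ → ℝ), 0 ≤ ∑ a ∈ S, ∑ b ∈ S, c a * c b * f (a + b))
    (S : Finset ℕ) (c : ℕ → ℝ) :
    |∑ a ∈ S, ∑ b ∈ S, c a * c b * f (a + b + 1)| ≤ ∑ a ∈ S, ∑ b ∈ S, c a * c b * f (a + b) := by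
  classical
  set n := S.sup id + 1 with hn
  have hS : S ⊆ range n := fun a ha =>
    mem_range.2 (Nat.lt_succ_of_le (by simpa using Finset.le_sup (f := id) ha))
  set c' : ℕ → ℝ := fun a => if a ∈ S then c a else 0 with hc'
  have key : ∀ g : ℕ → ℕ → ℝ, ∑ a ∈ S, ∑ b ∈ S, c a * c b * g a b
      = ∑ a ∈ range n, ∑ b ∈ range n, c' a * c' b * g a b := by
    intro g
    rw [← sum_subset hS (fun a _ ha => by simp [c', ha])]
    refine sum_congr rfl (fun a ha => ?_)
    rw [← sum_subset hS (fun b _ hb' => by simp [c', hb'])]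
    exact sum_congr rfl (fun b hb' => by simp [c', ha, hb'])
  rw [key (fun a b => f (a + b + 1)), key (fun a b => f (a + b))]
  exact abs_hankelForm_one_le_zero f hb (fun N d => hp (range N) d) n c'

/-- Difference-Hankel block `[f(a+b) − f(a+b+1)]_{a,b∈S} ⪰ 0` (HD-D0 of LIMIT-SOUNDNESS §S.3). -/
theorem hankel_sub_shift_nonneg (f : ℕ → ℝ) (hb : ∀ t, |f t| ≤ 1)
    (hp : ∀ (S : Finset ℕ) (c : ℕ → ℝ), 0 ≤ ∑ a ∈ S, ∑ b ∈ S, c a * c b * f (a + b))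
    (S : Finset ℕ) (c : ℕ → ℝ) :
    0 ≤ ∑ a ∈ S, ∑ b ∈ S, c a * c b * (f (a + b) - f (a + b + 1)) := by
  have h := (abs_le.1 (abs_hankel_shift_le f hb hp S c)).2
  have e : ∑ a ∈ S, ∑ b ∈ S, c a * c b * (f (a + b) - f (a + b + 1))
      = (∑ a ∈ S, ∑ b ∈ S, c a * c b * f (a + b)) - ∑ a ∈ S, ∑ b ∈ S, c a * c b * f (a + b + 1) := by
    simp only [mul_sub, sum_sub_distrib]
  rw [e]; linarith

/-- Sum-Hankel block `[f(a+b) + f(a+b+1)]_{a,b∈S} ⪰ 0` (the other half of `|h₁| ≤ h₀`). -/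
theorem hankel_add_shift_nonneg (f : ℕ → ℝ) (hb : ∀ t, |f t| ≤ 1)
    (hp : ∀ (S : Finset ℕ) (c : ℕ → ℝ), 0 ≤ ∑ a ∈ S, ∑ b ∈ S, c a * c b * f (a + b))
    (S : Finset ℕ) (c : ℕ → ℝ) :
    0 ≤ ∑ a ∈ S, ∑ b ∈ S, c a * c b * (f (a + b) + f (a + b + 1)) := by
  have h := (abs_le.1 (abs_hankel_shift_le f hb hp S c)).1
  have e : ∑ a ∈ S, ∑ b ∈ S, c a * c b * (f (a + b) + f (a + b + 1))
      = (∑ a ∈ S, ∑ b ∈ S, c a * c b * f (a + b)) + ∑ a ∈ S, ∑ b ∈ S, c a * c b * f (a + b + 1) := by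
    simp only [mul_add, sum_add_distrib]
  rw [e]; linarith

/-- Shifting preserves the hypotheses' shape: if all LINK-type Hankel forms `Σ c c f(a+b+1)` are non-negative
and `|f| ≤ 1`, then `[f(a+b+1) − f(a+b+2)] ⪰ 0` (HD-D1): apply the lemma to `t ↦ f (t+1)`. -/
theorem hankel_sub_shift_nonneg_succ (f : ℕ → ℝ) (hb : ∀ t, |f t| ≤ 1)
    (hq : ∀ (S : Finset ℕ) (c : ℕ → ℝ), 0 ≤ ∑ a ∈ S, ∑ b ∈ S, c a * c b * f (a + b + 1))
    (S : Finset ℕ) (c : ℕ → ℝ) :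
    0 ≤ ∑ a ∈ S, ∑ b ∈ S, c a * c b * (f (a + b + 1) - f (a + b + 2)) :=
  hankel_sub_shift_nonneg (fun t => f (t + 1)) (fun t => hb (t + 1)) hq S c

end Summit.QuantumFields.GaugeBoot.Hankel
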